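import Literature.Analysis.FluidPDE.MildSolution
import Literature.Analysis.FluidPDE.SpaceTimeCalculus
import Literature.Analysis.UnboundedOperators.HeatKernelHeatEquation
import Mathlib.MeasureTheory.Integral.DominatedConvergence
import Mathlib.MeasureTheory.Integral.Prod
import HarnessLib

/-!
# Classical solutions are mild solutions (Fabes–Jones–Rivière 1972, Thm. 2.1 (i)): discharge

Sibling proof file of `MildSolution.lean` (D-0014: named facts `def X : Prop` are discharged as
`theorem X_holds : X`). It discharges

* `Literature.Fluid.IsClassicalNSSolutionOn.isMildNSSolutionOn_holds :
  IsClassicalNSSolutionOn.isMildNSSolutionOn` — a classical solution `(u, p)` of the forced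
  Navier–Stokes system on a time set `S ⊇ [0, T]`, with `u`, `p`, `f` bounded on `[0, T] × E` and
  `0 < ν`, is a mild (very weak, duality-form) solution on `[0, T]` with datum `u 0`: every slice
  is weakly divergence free and, for every smooth compactly supported divergence-free `φ` and
  `t ∈ [0, T]`,
  `∫ ⟪u t, φ⟫ = ∫ ⟪u 0, e^{νtΔ}φ⟫ + ∫₀ᵗ ∫ ⟪u, (u·∇) e^{ν(t-τ)Δ}φ⟫ + ∫₀ᵗ ∫ ⟪f, e^{ν(t-τ)Δ}φ⟫`.

## Source and proof

E. B. Fabes, B. F. Jones, N. M. Rivière, *The initial value problem for the Navier–Stokes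
equations with data in `L^p`*, Arch. Rational Mech. Anal. 45 (1972) 222–240, Thm. 2.1 (i): the
equivalence of the differential (weak) and the integral (duality) formulations, obtained by
testing the equation with the caloric field `ψ(τ) = e^{ν(t-τ)Δ}φ`, which solves the backward heat
equation `∂_τψ + νΔψ = 0` and is divergence free (so that the pressure pairs to zero). The same
computation is Lemarié-Rieusset, *Recent developments in the Navier–Stokes problem* (2002),
Ch. 11, proof of Thm. 11.2. The paper itself is not held (`lit`: doi:10.1007/bf00281533 wanted);
the proof below is the standard one just described, made rigorous for merely *bounded* `u`, `p`,
`f` (no decay) by a spatial cut-off: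

1. (`cutoff_duality_ftc`) For a smooth compactly supported scalar cut-off `χ`, the function
   `g(τ) = ∫ ⟪u(τ), χ ψ(τ)⟫` is continuous on `[0, t]` and differentiable on `(0, t)` with
   `g' = ∫ (⟪∂_τu, χψ⟫ - ν χ ⟪u, Δψ⟫)` (differentiation under the integral sign, the heat equation
   `∂_τ ψ = -νΔψ` from `HeatKernelHeatEquation`); the fundamental theorem of calculus gives
   `g(t) - g(0) = ∫₀ᵗ g'`.
2. (`integral_inner_timeDerivWithin_eq`, `integral_duality_slice_eq`) Pairing the momentum
   equation with the (not divergence-free) field `χψ` and integrating by parts in `x`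
   (`WholeSpaceIBP`): `∫ ⟪∂_τu, χψ⟫ = ∫ (⟪u, (u·∇)(χψ)⟫ + ν⟪u, Δ(χψ)⟫ + p div(χψ) + ⟪f, χψ⟫)`;
   expanding `Δ(χψ) = χΔψ + 2Σᵢ ∂ᵢχ ∂ᵢψ + (Δχ)ψ`, `(u·∇)(χψ) = χ(u·∇)ψ + (Dχ·u)ψ`,
   `div(χψ) = Dχ·ψ` (`div ψ = 0`), the `χ⟪u, Δψ⟫` terms cancel and
   `g' = ∫ χ(⟪u, (u·∇)ψ⟫ + ⟪f, ψ⟫) + ∫ ((Dχ·u)⟪u, ψ⟫ + ν(2Σᵢ ∂ᵢχ⟪u, ∂ᵢψ⟫ + Δχ⟪u, ψ⟫) + p Dχ·ψ)`.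
3. (`isMildNSSolutionOn_holds`) With `χ = cutoff (n + 1)` (`= 1` on `‖x‖ ≤ n + 1`, gradient
   `O(1/n)`, Laplacian `O(1/n²)`), let `n → ∞`: at every fixed `(τ, x)` the integrand is eventually
   *equal* to `⟪u, (u·∇)ψ⟫ + ⟪f, ψ⟫`, and it is dominated by `A‖ψ(τ, x)‖ + B‖Dψ(τ, x)‖` with
   `ψ(τ), Dψ(τ) ∈ L¹` uniformly in `τ` (`‖e^{σΔ}g‖₁ ≤ ‖g‖₁`); dominated convergence in `x`, then in
   `τ`, and for the two boundary terms, gives the duality identity.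

## Contents

* caloric test field for all `σ` (`heatFlow`, `heatTest`): joint continuity
  (`continuous_uncurry_heatFlow`), derivatives and Laplacian fall on the data (`fderiv_heatFlow`,
  `laplacian_heatFlow`), divergence-freeness (`isDivFree_heatFlow`), `L¹` bounds
  (`integral_norm_heatFlow_le`), the backward heat equation along `τ ↦ e^{ν(t-τ)Δ}φ`
  (`hasDerivAt_heatTest_sub`) and joint smoothness below `t` (`contDiffOn_uncurry_heatTest_sub`);
* cut-offs: `fderiv_cutoff_eq_zero`, `laplacian_cutoff_eq_zero` (inside the ball),
  `exists_abs_laplacian_cutoff_le` (`|Δ cutoff R| ≤ C/R²`);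
* pointwise calculus: `laplacian_smul_apply` (Leibniz rule for `Δ(χΨ)`), `laplacian_comp_smul`;
* the three steps above.

## References

* E. B. Fabes, B. F. Jones, N. M. Rivière, Arch. Rational Mech. Anal. 45 (1972), Thm. 2.1.
  [FabesJonesRiviere1972]
* P. G. Lemarié-Rieusset, *Recent developments in the Navier–Stokes problem* (2002), Thm. 11.2.
  [LemarieRieusset2002]
* L. C. Evans, *Partial Differential Equations*, 2nd ed. (2010), §2.3.1, Thm. 1. [Evans2010]
-/

noncomputable section

open MeasureTheory TopologicalSpace Set Function Filter Topology InnerProductSpace Metric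
open scoped RealInnerProductSpace ENNReal NNReal Laplacian ContDiff

namespace Literature.Analysis.FluidPDE

/-! ### The caloric test field `e^{σΔ} g` for all `σ`: continuity, derivatives, divergence -/

section Caloric

variable {E : Type*} [NormedAddCommGroup E] [InnerProductSpace ℝ E] [FiniteDimensional ℝ E]
  [MeasurableSpace E] [BorelSpace E]
variable {F : Type*} [NormedAddCommGroup F] [NormedSpace ℝ F] [CompleteSpace F]

/-- **Joint continuity of the heat flow `(σ, x) ↦ e^{σΔ} g (x)` on all of `ℝ × E`** for bounded
continuous `g` (for `σ ≤ 0` the flow is `g` by definition): both `heatFlow g σ x` and the scaled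
caloric integral `∫ G_1(z) • g(x - √σ z) dz` agree for every real `σ`, and the latter is jointly
continuous. Evans, *PDE*, §2.3.1, Thm. 1 (iii). [cite: Evans2010, §2.3.1 Theorem 1(iii)] -/
theorem continuous_uncurry_heatFlow {g : E → F} (hg : Continuous g) {C : ℝ} (hC : ∀ z, ‖g z‖ ≤ C) :
    Continuous (uncurry (heatFlow g)) := by
  have h := UnboundedOperators.continuous_integral_heatKernel_one_smul hg hC
  refine h.congr fun q => ?_
  obtain ⟨σ, x⟩ := q
  change ∫ z, UnboundedOperators.heatKernel 1 z • g (x - Real.sqrt σ • z) = heatFlow g σ x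
  rcases le_or_gt σ 0 with hσ | hσ
  · rw [heatFlow_of_nonpos g hσ, UnboundedOperators.integral_heatKernel_one_smul_of_nonpos hσ]
  · rw [heatFlow_of_pos g hσ, UnboundedOperators.heatExtension_eq_integral_heatKernel_one hσ]

/-- Joint continuity of the caloric test field `(τ, x) ↦ e^{ν(t-τ)Δ} g (x)` on all of `ℝ × E`
for bounded continuous `g` (Evans, *PDE*, §2.3.1, Thm. 1 (iii)).
[cite: Evans2010, §2.3.1 Theorem 1(iii)] -/
theorem continuous_uncurry_heatTest_sub {g : E → F} (hg : Continuous g) {C : ℝ}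
    (hC : ∀ z, ‖g z‖ ≤ C) (ν t : ℝ) :
    Continuous fun q : ℝ × E => heatTest ν g (t - q.1) q.2 := by
  have h2 : Continuous fun q : ℝ × E => ((ν * (t - q.1), q.2) : ℝ × E) := by fun_prop
  exact (continuous_uncurry_heatFlow hg hC).comp h2

omit [CompleteSpace F] in
/-- **Derivatives fall on the data, for all `σ`**: `D(e^{σΔ} g)(x) = e^{σΔ}(Dg)(x)` for `g ∈ C¹_c`
(`σ ≤ 0`: both sides are `Dg(x)` by the definition of `heatFlow`). Lemarié-Rieusset 2016, §6.2.
[folklore] -/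
theorem fderiv_heatFlow {g : E → F} (hg : ContDiff ℝ 1 g) (hc : HasCompactSupport g) (σ : ℝ)
    (x : E) : fderiv ℝ (heatFlow g σ) x = heatFlow (fderiv ℝ g) σ x := by
  rcases le_or_gt σ 0 with hσ | hσ
  · rw [heatFlow_of_nonpos g hσ, heatFlow_of_nonpos _ hσ]
  · rw [heatFlow_of_pos g hσ, heatFlow_of_pos _ hσ]
    exact UnboundedOperators.fderiv_heatExtension_of_hasCompactSupport hg hc σ x

/-- **The Laplacian falls on the data, for all `σ`**: `Δ(e^{σΔ} g)(x) = e^{σΔ}(Δg)(x)` for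
`g ∈ C²_c`. Lemarié-Rieusset 2016, §6.2. [folklore] -/
theorem laplacian_heatFlow {g : E → F} (hg : ContDiff ℝ 2 g) (hc : HasCompactSupport g) (σ : ℝ)
    (x : E) : (Δ (heatFlow g σ)) x = heatFlow (Δ g) σ x := by
  rcases le_or_gt σ 0 with hσ | hσ
  · rw [heatFlow_of_nonpos g hσ, heatFlow_of_nonpos _ hσ]
  · rw [heatFlow_of_pos g hσ, heatFlow_of_pos _ hσ]
    exact UnboundedOperators.laplacian_heatExtension_of_hasCompactSupport hg hc σ x

omit [CompleteSpace F] in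
/-- The heat flow of `C^n` compactly supported data is `C^n` in space, for every `σ`. [folklore] -/
theorem contDiff_heatFlow {g : E → F} {n : ℕ∞} (hg : ContDiff ℝ n g) (hc : HasCompactSupport g)
    (σ : ℝ) : ContDiff ℝ n (heatFlow g σ) := by
  rcases le_or_gt σ 0 with hσ | hσ
  · rwa [heatFlow_of_nonpos g hσ]
  · rw [heatFlow_of_pos g hσ]
    exact UnboundedOperators.contDiff_heatExtension_of_hasCompactSupport hg hc σ

omit [CompleteSpace F] in
/-- **Sup bound, for all `σ`**: `‖e^{σΔ} g (x)‖ ≤ C` if `‖g‖ ≤ C` (maximum principle;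
Evans, *PDE*, §2.3.1). [folklore] -/
theorem norm_heatFlow_le {g : E → F} {C : ℝ} (hC : ∀ z, ‖g z‖ ≤ C) (σ : ℝ) (x : E) :
    ‖heatFlow g σ x‖ ≤ C := by
  rcases le_or_gt σ 0 with hσ | hσ
  · rw [heatFlow_of_nonpos g hσ]
    exact hC x
  · rw [heatFlow_of_pos g hσ]
    exact UnboundedOperators.norm_heatExtension_le hC hσ x

/-- The heat flow of an integrable field is integrable, for every `σ` (Giga–Giga–Saal, §1.1.2).
[folklore] -/
theorem integrable_heatFlow {g : E → F} (hg : Integrable g) (σ : ℝ) :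
    Integrable (heatFlow g σ) := by
  rcases le_or_gt σ 0 with hσ | hσ
  · rwa [heatFlow_of_nonpos g hσ]
  · rw [heatFlow_of_pos g hσ]
    exact UnboundedOperators.integrable_heatExtension hg hσ

/-- **`L¹` contraction of the heat flow**, real-integral form: `∫ ‖e^{σΔ} g‖ ≤ ∫ ‖g‖` for
integrable `g` and every `σ` (Giga–Giga–Saal, *Nonlinear PDEs*, §1.1.2). [folklore] -/
theorem integral_norm_heatFlow_le {g : E → F} (hg : Integrable g) (σ : ℝ) :
    ∫ x, ‖heatFlow g σ x‖ ≤ ∫ x, ‖g x‖ := by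
  rcases le_or_gt σ 0 with hσ | hσ
  · rw [heatFlow_of_nonpos g hσ]
  · rw [heatFlow_of_pos g hσ,
      integral_norm_eq_lintegral_enorm (UnboundedOperators.integrable_heatExtension hg hσ).aestronglyMeasurable,
      integral_norm_eq_lintegral_enorm hg.aestronglyMeasurable]
    exact ENNReal.toReal_mono hg.2.ne (UnboundedOperators.lintegral_enorm_heatExtension_le hg hσ)

/-- **The heat flow of a divergence-free test field is divergence free**: for `φ ∈ C¹_c` with
`div φ = 0`, `div (e^{σΔ} φ) = e^{σΔ} (div φ) = 0` for every `σ` (Fabes–Jones–Rivière 1972, §2: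
the caloric test field is solenoidal; the trace is a continuous linear functional and commutes
with the caloric extension). [cite: FabesJonesRiviere1972, §2] -/
theorem isDivFree_heatFlow {φ : E → E} (hφ : ContDiff ℝ 1 φ) (hc : HasCompactSupport φ)
    (hdiv : VectorCalculus.IsDivFree φ) (σ : ℝ) : VectorCalculus.IsDivFree (heatFlow φ σ) := by
  intro x
  rcases le_or_gt σ 0 with hσ | hσ
  · rw [heatFlow_of_nonpos φ hσ]
    exact hdiv x
  · -- the trace as a continuous linear functional on `E →L[ℝ] E`
    let L : (E →L[ℝ] E) →L[ℝ] ℝ :=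
      LinearMap.toContinuousLinearMap ((LinearMap.trace ℝ E).comp (ContinuousLinearMap.coeLM ℝ))
    have hL : ∀ T : E →L[ℝ] E, L T = LinearMap.trace ℝ E (T : E →ₗ[ℝ] E) := fun T => rfl
    have h0 : (fun z => L (fderiv ℝ φ z)) = fun _ => (0 : ℝ) := funext fun z => hdiv z
    change LinearMap.trace ℝ E (fderiv ℝ (heatFlow φ σ) x : E →ₗ[ℝ] E) = 0
    rw [← hL, heatFlow_of_pos φ hσ, UnboundedOperators.fderiv_heatExtension_of_hasCompactSupport hφ hc σ x,
      ← UnboundedOperators.heatExtension_clm_comp L (hφ.continuous_fderiv one_ne_zero) (hc.fderiv ℝ) σ x, h0,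
      UnboundedOperators.heatExtension_zero_fun]
    rfl

/-- **The backward heat equation along the caloric test field.** For `φ ∈ C²_c`, `0 < ν` and
`τ < t`, `d/ds e^{ν(t-s)Δ}φ (x) |_{s=τ} = -ν e^{ν(t-τ)Δ}(Δφ)(x)` (chain rule with
`hasDerivAt_heatExtension_time_of_hasCompactSupport`; Fabes–Jones–Rivière 1972, §2: `ψ` solves
`∂_τψ + νΔψ = 0`). [cite: FabesJonesRiviere1972, §2] -/
theorem hasDerivAt_heatTest_sub {φ : E → F} (hφ : ContDiff ℝ 2 φ) (hc : HasCompactSupport φ)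
    {ν t τ : ℝ} (hν : 0 < ν) (hτ : τ < t) (x : E) :
    HasDerivAt (fun s => heatTest ν φ (t - s) x) (-(ν • heatFlow (Δ φ) (ν * (t - τ)) x)) τ := by
  have hσ : 0 < ν * (t - τ) := mul_pos hν (sub_pos.2 hτ)
  have h1 : HasDerivAt (fun σ => UnboundedOperators.heatExtension φ σ x) (UnboundedOperators.heatExtension (Δ φ) (ν * (t - τ)) x)
      (ν * (t - τ)) :=
    UnboundedOperators.hasDerivAt_heatExtension_time_of_hasCompactSupport hφ hc hσ x
  have h2 : HasDerivAt (fun s => ν * (t - s)) (-ν) τ := by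
    simpa using ((hasDerivAt_id τ).const_sub t).const_mul ν
  have h3 := h1.scomp τ h2
  have heq : (fun s => heatTest ν φ (t - s) x) =ᶠ[𝓝 τ]
      ((fun σ => UnboundedOperators.heatExtension φ σ x) ∘ fun s => ν * (t - s)) := by
    filter_upwards [Iio_mem_nhds hτ] with s hs
    simp only [Function.comp_def, heatTest, heatFlow_of_pos φ (mul_pos hν (sub_pos.2 hs))]
  refine (h3.congr_of_eventuallyEq heq).congr_deriv ?_
  rw [neg_smul, heatFlow_of_pos _ hσ]

omit [CompleteSpace F] in
/-- **Joint smoothness of the caloric test field below the final time**: for compactly supported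
locally integrable `φ` and `0 < ν`, `(τ, x) ↦ e^{ν(t-τ)Δ}φ (x)` is `C^∞` on `(-∞, t) × E`
(from `contDiffOn_uncurry_heatExtension`; Evans, *PDE*, §2.3.1, Thm. 1 (i)).
[cite: Evans2010, §2.3.1 Theorem 1(i)] -/
theorem contDiffOn_uncurry_heatTest_sub {φ : E → F} (hφ : LocallyIntegrable φ volume)
    (hc : HasCompactSupport φ) {ν : ℝ} (hν : 0 < ν) (t : ℝ) {m : ℕ∞} :
    ContDiffOn ℝ m (fun q : ℝ × E => heatTest ν φ (t - q.1) q.2) (Iio t ×ˢ univ) := by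
  have hmap : ContDiff ℝ m (fun q : ℝ × E => ((ν * (t - q.1), q.2) : ℝ × E)) := by fun_prop
  have hmaps : MapsTo (fun q : ℝ × E => ((ν * (t - q.1), q.2) : ℝ × E)) (Iio t ×ˢ univ)
      (Ioi 0 ×ˢ univ) := fun q hq =>
    ⟨mul_pos hν (sub_pos.2 (mem_prod.1 hq).1), mem_univ _⟩
  have h := (UnboundedOperators.contDiffOn_uncurry_heatExtension hφ hc (m := m)).comp hmap.contDiffOn hmaps
  refine h.congr fun q hq => ?_
  change heatFlow φ (ν * (t - q.1)) q.2 = UnboundedOperators.heatExtension φ (ν * (t - q.1)) q.2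
  rw [heatFlow_of_pos φ (mul_pos hν (sub_pos.2 (mem_prod.1 hq).1))]

end Caloric

/-! ### Pointwise calculus: the Laplacian of a product and of the cut-off -/

section Pointwise

variable {E : Type*} [NormedAddCommGroup E] [InnerProductSpace ℝ E] [FiniteDimensional ℝ E]
variable {F' : Type*} [NormedAddCommGroup F'] [InnerProductSpace ℝ F']

/-- **Leibniz rule for the Laplacian of a scalar multiple**: for `χ ∈ C²(E; ℝ)`, `Ψ ∈ C²(E; F')`
and the standard orthonormal frame `b`,
`Δ(χ Ψ) = χ ΔΨ + 2 Σᵢ (∂ᵢχ) ∂ᵢΨ + (Δχ) Ψ`. [folklore] -/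
theorem laplacian_smul_apply {χ : E → ℝ} {Ψ : E → F'} (hχ : ContDiff ℝ 2 χ) (hΨ : ContDiff ℝ 2 Ψ)
    (x : E) :
    (Δ (fun y => χ y • Ψ y)) x = χ x • (Δ Ψ) x +
      (2 : ℝ) • ∑ i, (fderiv ℝ χ x (stdOrthonormalBasis ℝ E i)) •
        fderiv ℝ Ψ x (stdOrthonormalBasis ℝ E i) + ((Δ χ) x) • Ψ x := by
  set b := stdOrthonormalBasis ℝ E with hb
  have hχ1 : ContDiff ℝ 1 χ := hχ.of_le one_le_two
  have hΨ1 : ContDiff ℝ 1 Ψ := hΨ.of_le one_le_two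
  have hχd : ∀ y, DifferentiableAt ℝ χ y := fun y => hχ1.differentiable one_ne_zero y
  have hΨd : ∀ y, DifferentiableAt ℝ Ψ y := fun y => hΨ1.differentiable one_ne_zero y
  have hχi : ∀ e, ContDiff ℝ 1 fun y => fderiv ℝ χ y e := fun e =>
    (hχ.fderiv_right (m := 1) le_rfl).clm_apply contDiff_const
  have hΨi : ∀ e, ContDiff ℝ 1 fun y => fderiv ℝ Ψ y e := fun e =>
    (hΨ.fderiv_right (m := 1) le_rfl).clm_apply contDiff_const
  have hχid : ∀ e y, DifferentiableAt ℝ (fun y => fderiv ℝ χ y e) y := fun e y =>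
    (hχi e).differentiable one_ne_zero y
  have hΨid : ∀ e y, DifferentiableAt ℝ (fun y => fderiv ℝ Ψ y e) y := fun e y =>
    (hΨi e).differentiable one_ne_zero y
  have hprod : ContDiff ℝ 2 fun y => χ y • Ψ y := hχ.smul hΨ
  -- first derivatives of the product along `e`
  have h1 : ∀ e, (fun y => fderiv ℝ (fun y => χ y • Ψ y) y e) =
      fun y => χ y • fderiv ℝ Ψ y e + fderiv ℝ χ y e • Ψ y := fun e => by
    funext y
    rw [fderiv_fun_smul (hχd y) (hΨd y)]
    simp
  -- second derivatives along `e`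
  have h2 : ∀ e, fderiv ℝ (fun y => fderiv ℝ (fun y => χ y • Ψ y) y e) x e =
      χ x • fderiv ℝ (fun y => fderiv ℝ Ψ y e) x e + (2 : ℝ) • (fderiv ℝ χ x e • fderiv ℝ Ψ x e) +
        fderiv ℝ (fun y => fderiv ℝ χ y e) x e • Ψ x := fun e => by
    rw [h1 e]
    rw [fderiv_fun_add ((hχd x).fun_smul (hΨid e x)) ((hχid e x).fun_smul (hΨd x)),
      fderiv_fun_smul (hχd x) (hΨid e x), fderiv_fun_smul (hχid e x) (hΨd x)]
    simp only [_root_.add_apply, _root_.FunLike.coe_smul, Pi.smul_apply,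
      ContinuousLinearMap.smulRight_apply, two_smul]
    abel
  rw [laplacian_eq_sum_fderiv_fderiv b hprod, laplacian_eq_sum_fderiv_fderiv b hΨ,
    laplacian_eq_sum_fderiv_fderiv b hχ]
  simp only [h2, Finset.sum_add_distrib, Finset.smul_sum, Finset.sum_smul]

/-- The Laplacian of a rescaled function: `Δ(f(c ·))(x) = c² (Δf)(c x)`. [folklore] -/
theorem laplacian_comp_smul {f : E → F'} (hf : ContDiff ℝ 2 f) (c : ℝ) (x : E) :
    (Δ (fun y => f (c • y))) x = c ^ 2 • (Δ f) (c • x) := by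
  set b := stdOrthonormalBasis ℝ E with hb
  have hfc : ContDiff ℝ 2 fun y => f (c • y) := hf.comp (contDiff_const_smul c)
  rw [laplacian_eq_sum_fderiv_fderiv b hfc, laplacian_eq_sum_fderiv_fderiv b hf, Finset.smul_sum]
  refine Finset.sum_congr rfl fun i _ => ?_
  set g : E → F' := fun z => fderiv ℝ f z (b i) with hg
  have hgd : Differentiable ℝ g :=
    ((hf.fderiv_right (m := 1) le_rfl).clm_apply contDiff_const).differentiable one_ne_zero
  have h1 : (fun y => fderiv ℝ (fun y => f (c • y)) y (b i)) = fun y => c • g (c • y) := by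
    funext y
    rw [fderiv_comp_smul c]
    rfl
  have h2 : HasFDerivAt (fun y => c • g (c • y))
      (c • ((fderiv ℝ g (c • x)).comp (c • ContinuousLinearMap.id ℝ E))) x := by
    have := (hgd (c • x)).hasFDerivAt.comp x ((hasFDerivAt_id x).const_smul c)
    exact this.const_smul c
  rw [h1, h2.fderiv]
  simp [hg, pow_two, smul_smul]

end Pointwise
/-! ### Cut-offs: derivatives vanish inside the ball; the Laplacian is `O(1/R²)` -/

section Cutoff

variable {E : Type*} [NormedAddCommGroup E] [InnerProductSpace ℝ E]

/-- Inside the ball of radius `R` the cut-off is locally the constant `1`. [folklore] -/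
theorem MildSolutionProofs.cutoff_eventuallyEq_one {R : ℝ} (hR : 0 < R) {x : E} (hx : ‖x‖ < R) :
    cutoff R =ᶠ[𝓝 x] fun _ => (1 : ℝ) := by
  filter_upwards [isOpen_ball.mem_nhds (mem_ball_zero_iff.2 hx)] with y hy
  exact cutoff_eq_one hR (mem_ball_zero_iff.1 hy).le

/-- Inside the ball of radius `R` the gradient of the cut-off vanishes. [folklore] -/
theorem fderiv_cutoff_eq_zero {R : ℝ} (hR : 0 < R) {x : E} (hx : ‖x‖ < R) :
    fderiv ℝ (cutoff R) x = 0 := by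
  rw [(MildSolutionProofs.cutoff_eventuallyEq_one hR hx).fderiv_eq]
  exact fderiv_const_apply _

variable [FiniteDimensional ℝ E]

/-- Inside the ball of radius `R` the Laplacian of the cut-off vanishes. [folklore] -/
theorem laplacian_cutoff_eq_zero {R : ℝ} (hR : 0 < R) {x : E} (hx : ‖x‖ < R) :
    (Δ (cutoff R : E → ℝ)) x = 0 := by
  rw [laplacian_eq_sum_fderiv_fderiv (stdOrthonormalBasis ℝ E) (contDiff_cutoff R)]
  refine Finset.sum_eq_zero fun i _ => ?_
  have h : (fun y => fderiv ℝ (cutoff R) y (stdOrthonormalBasis ℝ E i)) =ᶠ[𝓝 x]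
      fun _ => (0 : ℝ) := by
    filter_upwards [isOpen_ball.mem_nhds (mem_ball_zero_iff.2 hx)] with y hy
    rw [fderiv_cutoff_eq_zero hR (mem_ball_zero_iff.1 hy)]
    rfl
  rw [h.fderiv_eq, fderiv_const_apply]
  rfl

omit [FiniteDimensional ℝ E] in
/-- The topological support of the cut-off lies in the closed ball of radius `2R`. [folklore] -/
theorem tsupport_cutoff_subset {R : ℝ} (hR : 0 < R) :
    tsupport (cutoff (E := E) R) ⊆ closedBall (0 : E) (2 * R) := by
  refine closure_minimal (fun x hx => ?_) isClosed_closedBall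
  rw [mem_closedBall_zero_iff]
  by_contra h
  exact hx (cutoff_eq_zero hR (not_le.1 h).le)

/-- **Laplacian bound for the cut-off.** There is `C ≥ 0` with `|Δ(cutoff R)(x)| ≤ C / R²` for
all `R > 0` and all `x` (scaling `Δ(χ(·/R)) = R⁻² (Δχ)(·/R)` and boundedness of `Δχ`). [folklore] -/
theorem exists_abs_laplacian_cutoff_le :
    ∃ C : ℝ, 0 ≤ C ∧ ∀ R : ℝ, 0 < R → ∀ x : E, |(Δ (cutoff R : E → ℝ)) x| ≤ C / R ^ 2 := by
  have h2 : ContDiff ℝ 2 (FunctionSpaces.dyadicCutoff E) := (FunctionSpaces.dyadicCutoff E).contDiff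
  have hcs : HasCompactSupport (Δ (FunctionSpaces.dyadicCutoff E : E → ℝ)) :=
    HasCompactSupport.intro (FunctionSpaces.dyadicCutoff E).hasCompactSupport fun x hx =>
      laplacian_eq_zero_of_notMem_tsupport hx
  obtain ⟨C, hC⟩ := (continuous_laplacian h2).bounded_above_of_compact_support hcs
  refine ⟨max C 0, le_max_right _ _, fun R hR x => ?_⟩
  have hdef : cutoff (E := E) R = fun y => FunctionSpaces.dyadicCutoff E (R⁻¹ • y) := rfl
  rw [hdef, laplacian_comp_smul h2 R⁻¹ x, smul_eq_mul, abs_mul, abs_of_nonneg (by positivity),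
    inv_pow, div_eq_inv_mul]
  gcongr
  exact (Real.norm_eq_abs _ ▸ hC _).trans (le_max_left _ _)

end Cutoff

/-! ### The slice identity with the pressure kept (non-solenoidal tests) -/

section Slice

variable {E : Type*} [NormedAddCommGroup E] [InnerProductSpace ℝ E] [FiniteDimensional ℝ E]
  [MeasurableSpace E] [BorelSpace E]

variable {ν : ℝ} {f u : ℝ → E → E} {p : ℝ → E → ℝ}

/-- **Slice identity for an arbitrary compactly supported test field.** For a classical
solution on a time set `S` of unique differentiability, `t ∈ S`, and `w ∈ C²_c(E; E)` (not
necessarily divergence free), pairing the momentum equation with `w` and integrating by parts in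
`x` gives `∫ ⟪∂ₜu(t), w⟫ = ∫ (⟪u, (u·∇)w⟫ + ν⟪u, Δw⟫ + p div w + ⟪f, w⟫)` (the pressure term
`∫ ⟪∇p, w⟫ = -∫ p div w` is kept; Fabes–Jones–Rivière 1972, §2, the weak form (2.2) before
restricting to solenoidal tests; Leray 1934, (17)). [cite: FabesJonesRiviere1972, §2] -/
theorem IsClassicalNSSolutionOn.integral_inner_timeDerivWithin_eq {S : Set ℝ}
    (h : IsClassicalNSSolutionOn S ν f u p) (hS : UniqueDiffOn ℝ S) {t : ℝ} (ht : t ∈ S)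
    {w : E → E} (hw : ContDiff ℝ 2 w) (hc : HasCompactSupport w) :
    ∫ x, ⟪timeDerivWithin S u t x, w x⟫ =
      ∫ x, (⟪u t x, convect (u t) w x⟫ + ν * ⟪u t x, (Δ w) x⟫ + p t x * VectorCalculus.divergence w x +
        ⟪f t x, w x⟫) := by
  -- regularity of the slices
  have hu2 : ContDiff ℝ 2 (u t) := contDiff_infty.1 (h.contDiff_velocity ht) 2
  have hu1 : ContDiff ℝ 1 (u t) := hu2.of_le one_le_two
  have hp1 : ContDiff ℝ 1 (p t) := contDiff_infty.1 (h.contDiff_pressure ht) 1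
  have hw1 : ContDiff ℝ 1 w := hw.of_le one_le_two
  have huc : Continuous (u t) := hu1.continuous
  have hwc : Continuous w := hw1.continuous
  have hdtc : Continuous (timeDerivWithin S u t) :=
    ((h.smooth_velocity.timeDerivWithin hS).contDiff_slice ht).continuous
  -- the force through the equation
  have hf_eq : ∀ x, f t x = timeDerivWithin S u t x + convect (u t) (u t) x - ν • (Δ (u t)) x +
      gradient (p t) x := fun x => by
    have := h.momentum t ht x
    rw [eq_comm, ← sub_eq_zero] at this
    rw [← sub_eq_zero, ← this]
    abel
  have hfc : Continuous (f t) := h.continuous_force_slice hS ht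
  -- integrability of every pairing with `w`
  have iC : Integrable (fun x => ⟪convect (u t) (u t) x, w x⟫) (volume : Measure E) :=
    integrable_inner_of_hasCompactSupport_right
      ((hu1.continuous_fderiv one_ne_zero).clm_apply huc) hwc hc
  have iL := integrable_inner_of_hasCompactSupport_right (continuous_laplacian hu2) hwc hc
  have iP := integrable_inner_of_hasCompactSupport_right (continuous_gradient_of_contDiff hp1)
    hwc hc
  have iF := integrable_inner_of_hasCompactSupport_right hfc hwc hc
  have iC' : Integrable (fun x => ⟪u t x, convect (u t) w x⟫) (volume : Measure E) :=
    integrable_inner_of_hasCompactSupport_right huc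
      ((hw1.continuous_fderiv one_ne_zero).clm_apply huc)
      ((hc.fderiv (𝕜 := ℝ)).mono fun x hx => by
        contrapose! hx; simp only [mem_support, not_not] at hx; simp [convect, hx])
  have iL' : Integrable (fun x => ⟪u t x, (Δ w) x⟫) (volume : Measure E) :=
    integrable_inner_of_hasCompactSupport_right huc (continuous_laplacian hw)
      (hc.mono' fun x hx => by
        contrapose! hx; simp [laplacian_eq_zero_of_notMem_tsupport hx])
  have iD : Integrable (fun x => p t x * VectorCalculus.divergence w x) (volume : Measure E) :=
    (hp1.continuous.mul (continuous_divergence (hw1.continuous_fderiv one_ne_zero)))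
      |>.integrable_of_hasCompactSupport (hc.mono' fun x hx => by
        contrapose! hx; simp [divergence_eq_zero_of_notMem_tsupport hx]).mul_left
  -- integration by parts, term by term
  have eC : ∫ x, ⟪convect (u t) (u t) x, w x⟫ = -∫ x, ⟪u t x, convect (u t) w x⟫ := by
    have h0 := integral_inner_convect_add_eq_zero hu1 hu1 hw1 hc
    have hz : ∫ x, VectorCalculus.divergence (u t) x * ⟪u t x, w x⟫ = 0 := by
      simp [h.divFree t ht _]
    linarith
  have eL : ∫ x, ⟪(Δ (u t)) x, w x⟫ = ∫ x, ⟪u t x, (Δ w) x⟫ :=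
    integral_inner_laplacian_comm hu2 hw hc
  have eP : ∫ x, ⟪gradient (p t) x, w x⟫ = -∫ x, p t x * VectorCalculus.divergence w x :=
    integral_inner_gradient_eq_neg_integral_mul_divergence hp1 hw1 hc
  -- assemble
  have key : ∀ x, ⟪timeDerivWithin S u t x, w x⟫ = ⟪f t x, w x⟫ -
      ⟪convect (u t) (u t) x, w x⟫ + ν * ⟪(Δ (u t)) x, w x⟫ - ⟪gradient (p t) x, w x⟫ := by
    intro x
    rw [hf_eq x]
    simp only [inner_add_left, inner_sub_left, inner_smul_left, RCLike.conj_to_real]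
    ring
  have j1 : Integrable (fun x => ⟪f t x, w x⟫ - ⟪convect (u t) (u t) x, w x⟫)
      (volume : Measure E) := iF.sub iC
  have j2 : Integrable (fun x => ν * ⟪(Δ (u t)) x, w x⟫) (volume : Measure E) := iL.const_mul ν
  have j3 : Integrable (fun x => ⟪f t x, w x⟫ - ⟪convect (u t) (u t) x, w x⟫ +
      ν * ⟪(Δ (u t)) x, w x⟫) (volume : Measure E) := j1.add j2
  have j4 : Integrable (fun x => ν * ⟪u t x, (Δ w) x⟫) (volume : Measure E) := iL'.const_mul ν
  have j5 : Integrable (fun x => ⟪u t x, convect (u t) w x⟫ + ν * ⟪u t x, (Δ w) x⟫)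
      (volume : Measure E) := iC'.add j4
  have j6 : Integrable (fun x => ⟪u t x, convect (u t) w x⟫ + ν * ⟪u t x, (Δ w) x⟫ +
      p t x * VectorCalculus.divergence w x) (volume : Measure E) := j5.add iD
  rw [integral_congr_ae (Eventually.of_forall key), integral_sub j3 iP, integral_add j1 j2,
    integral_sub iF iC, integral_const_mul, integral_add j6 iF, integral_add j5 iD,
    integral_add iC' j4, integral_const_mul, eC, eL, eP]
  ring

end Slice

/-! ### Step 1–2: the cut-off duality function, its derivative, and the slice expansion -/

section Duality

variable {E : Type*} [NormedAddCommGroup E] [InnerProductSpace ℝ E] [FiniteDimensional ℝ E]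
  [MeasurableSpace E] [BorelSpace E]

variable {ν T : ℝ} {f u : ℝ → E → E} {p : ℝ → E → ℝ}

/-- **Step 1 (fundamental theorem of calculus for the cut-off duality function).** For a
classical solution on `[0, T]`, `0 < t ≤ T`, `0 < ν`, a smooth compactly supported field `φ` and
a smooth compactly supported scalar cut-off `χ`, the function `g(τ) = ∫ ⟪u(τ), χ e^{ν(t-τ)Δ}φ⟫`
satisfies `g(t) - g(0) = ∫₀ᵗ ∫ (⟪∂_τu, χψ⟫ - ν χ ⟪u, Δψ⟫)`, `ψ(τ) = e^{ν(t-τ)Δ}φ`: continuity of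
`g` on `[0, t]` and differentiation under the integral sign on `(0, t)` (compact `x`-support,
joint smoothness of `u` and of `ψ` below `t`), with `∂_τψ = -νΔψ`
(Fabes–Jones–Rivière 1972, §2, proof of Thm. 2.1). [cite: FabesJonesRiviere1972, §2 Thm. 2.1] -/
theorem IsClassicalNSSolutionOn.cutoff_duality_ftc (h : IsClassicalNSSolutionOn (Icc 0 T) ν f u p)
    (hν : 0 < ν) {t : ℝ} (ht0 : 0 < t) (htT : t ≤ T) {φ : E → E} (hφ : ContDiff ℝ ∞ φ)
    (hφc : HasCompactSupport φ) {χ : E → ℝ} (hχ : ContDiff ℝ ∞ χ) (hχc : HasCompactSupport χ) :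
    (∫ x, ⟪u t x, χ x • φ x⟫) - ∫ x, ⟪u 0 x, χ x • heatTest ν φ t x⟫ =
      ∫ τ in 0..t, ∫ x, (⟪timeDerivWithin (Icc 0 T) u τ x, χ x • heatTest ν φ (t - τ) x⟫ -
        ν * (χ x * ⟪u τ x, (Δ (heatTest ν φ (t - τ))) x⟫)) := by
  have hT : 0 < T := ht0.trans_le htT
  set S₀ : Set ℝ := Icc 0 T with hS₀
  have hU : UniqueDiffOn ℝ S₀ := uniqueDiffOn_Icc hT
  have hIt : Icc 0 t ⊆ S₀ := Icc_subset_Icc le_rfl htT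
  have hIo : Ioo 0 t ⊆ S₀ := Ioo_subset_Icc_self.trans hIt
  -- the caloric test field and its regularity
  set Ψ : ℝ → E → E := fun τ => heatTest ν φ (t - τ) with hΨ
  have hφ2 : ContDiff ℝ 2 φ := contDiff_infty.1 hφ 2
  obtain ⟨Cφ, hCφ⟩ := hφ.continuous.bounded_above_of_compact_support hφc
  have hΔφc : Continuous (Δ φ) := continuous_laplacian hφ2
  have hΔφs : HasCompactSupport (Δ φ) :=
    hφc.mono' fun x hx => by
      contrapose! hx
      simp [laplacian_eq_zero_of_notMem_tsupport hx]
  obtain ⟨CΔ, hCΔ⟩ := hΔφc.bounded_above_of_compact_support hΔφs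
  have hΨc : Continuous (uncurry Ψ) := continuous_uncurry_heatTest_sub hφ.continuous hCφ ν t
  have hΔΨ : ∀ τ x, (Δ (Ψ τ)) x = heatFlow (Δ φ) (ν * (t - τ)) x := fun τ x =>
    laplacian_heatFlow hφ2 hφc _ x
  have hΔΨc : Continuous fun q : ℝ × E => (Δ (Ψ q.1)) q.2 := by
    simp only [hΔΨ]
    exact continuous_uncurry_heatTest_sub hΔφc hCΔ ν t
  have hΨs : IsSmoothSpaceTimeOn (Ioo 0 t) Ψ :=
    (contDiffOn_uncurry_heatTest_sub hφ.continuous.locallyIntegrable hφc hν t).mono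
      (prod_mono Ioo_subset_Iio_self Subset.rfl)
  -- the solution's regularity
  have hu_cont : ContinuousOn (uncurry u) (S₀ ×ˢ univ) := h.smooth_velocity.continuousOn
  have hdt_cont : ContinuousOn (uncurry (timeDerivWithin S₀ u)) (S₀ ×ˢ univ) :=
    (h.smooth_velocity.timeDerivWithin hU).continuousOn
  have hχc' : Continuous χ := hχ.continuous
  -- compact `x`-support
  set K : Set E := tsupport χ with hK
  have hKc : IsCompact K := hχc
  have hχK : ∀ x ∉ K, χ x = 0 := fun x hx => image_eq_zero_of_notMem_tsupport hx
  -- the duality integrand and its time derivative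
  set Φ : ℝ → E → ℝ := fun τ x => ⟪u τ x, χ x • Ψ τ x⟫ with hΦ
  set D : ℝ → E → ℝ := fun τ x => ⟪timeDerivWithin S₀ u τ x, χ x • Ψ τ x⟫ -
    ν * (χ x * ⟪u τ x, (Δ (Ψ τ)) x⟫) with hD
  have hΦK : ∀ τ, ∀ x ∉ K, Φ τ x = 0 := fun τ x hx => by simp [hΦ, hχK x hx]
  have hDK : ∀ τ, ∀ x ∉ K, D τ x = 0 := fun τ x hx => by simp [hD, hχK x hx]
  have hχΨc : Continuous fun q : ℝ × E => χ q.2 • Ψ q.1 q.2 :=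
    (hχc'.comp continuous_snd).smul hΨc
  have hΦc : ContinuousOn (uncurry Φ) (Icc 0 t ×ˢ univ) :=
    ContinuousOn.inner (hu_cont.mono (prod_mono hIt Subset.rfl)) hχΨc.continuousOn
  have hDc : ContinuousOn (uncurry D) (Icc 0 t ×ˢ univ) := by
    refine ContinuousOn.sub
      (ContinuousOn.inner (hdt_cont.mono (prod_mono hIt Subset.rfl)) hχΨc.continuousOn) ?_
    refine continuousOn_const.mul ((hχc'.comp continuous_snd).continuousOn.mul ?_)
    exact ContinuousOn.inner (hu_cont.mono (prod_mono hIt Subset.rfl)) hΔΨc.continuousOn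
  -- the duality function `g` and its derivative
  have hg_cont : ContinuousOn (fun τ => ∫ x, Φ τ x) (Icc 0 t) :=
    continuousOn_integral_of_support_subset (μ := volume) hKc hΦc fun τ _ x hx => hΦK τ x hx
  have hG_cont : ContinuousOn (fun τ => ∫ x, D τ x) (Icc 0 t) :=
    continuousOn_integral_of_support_subset (μ := volume) hKc hDc fun τ _ x hx => hDK τ x hx
  have hG_int : IntervalIntegrable (fun τ => ∫ x, D τ x) volume 0 t := by
    refine ContinuousOn.intervalIntegrable ?_
    rwa [uIcc_of_le ht0.le]
  have hΦs : IsSmoothSpaceTimeOn (Ioo 0 t) Φ :=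
    (h.smooth_velocity.mono hIo).inner ((isSmoothSpaceTimeOn_const_time hχ _).smul hΨs)
  have hderiv : ∀ τ ∈ Ioo 0 t, HasDerivAt (fun s => ∫ x, Φ s x) (∫ x, D τ x) τ := by
    intro τ hτ
    have key := hasDerivAt_integral_of_support_subset (μ := (volume : Measure E)) isOpen_Ioo hΦs
      hKc (fun s _ x hx => hΦK s x hx) hτ
    have hD_eq : ∀ x, deriv (fun s => Φ s x) τ = D τ x := by
      intro x
      have hu' : HasDerivAt (fun s => u s x) (timeDerivWithin S₀ u τ x) τ :=
        (h.smooth_velocity.hasDerivWithinAt_timeDerivWithin hU (hIo hτ) x).hasDerivAt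
          (Icc_mem_nhds hτ.1 (hτ.2.trans_le htT))
      have hΨ' : HasDerivAt (fun s => χ x • Ψ s x)
          (χ x • -(ν • heatFlow (Δ φ) (ν * (t - τ)) x)) τ :=
        (hasDerivAt_heatTest_sub hφ2 hφc hν hτ.2 x).const_smul (χ x)
      have hI : HasDerivAt (fun s => Φ s x)
          (⟪u τ x, χ x • -(ν • heatFlow (Δ φ) (ν * (t - τ)) x)⟫ +
            ⟪timeDerivWithin S₀ u τ x, χ x • Ψ τ x⟫) τ := hu'.inner ℝ hΨ'
      rw [hI.deriv]
      simp only [hD, hΔΨ, inner_smul_right, inner_neg_right]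
      ring
    have heqI : (∫ x, deriv (fun s => Φ s x) τ) = ∫ x, D τ x :=
      integral_congr_ae (Eventually.of_forall hD_eq)
    exact key.congr_deriv heqI
  -- the fundamental theorem of calculus
  have hftc := intervalIntegral.integral_eq_sub_of_hasDerivAt_of_le ht0.le hg_cont hderiv hG_int
  have hΦt : ∀ x, Φ t x = ⟪u t x, χ x • φ x⟫ := fun x => by simp [hΦ, hΨ]
  have hΦ0 : ∀ x, Φ 0 x = ⟪u 0 x, χ x • heatTest ν φ t x⟫ := fun x => by simp [hΦ, hΨ]
  rw [integral_congr_ae (Eventually.of_forall hΦt), integral_congr_ae (Eventually.of_forall hΦ0)]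
    at hftc
  exact hftc.symm

/-- **Step 2 (the slice expansion).** For a classical solution on a time set `S` of unique
differentiability, `τ ∈ S`, a divergence-free `C²` field `Ψ` (no decay required) and a `C²`
compactly supported scalar cut-off `χ`: pairing `∂_τu` with `χΨ` through the momentum equation
(`integral_inner_timeDerivWithin_eq`) and expanding `(u·∇)(χΨ)`, `Δ(χΨ)`, `div(χΨ) = DΨ·χ`
gives
`∫ (⟪∂_τu, χΨ⟫ - νχ⟪u, ΔΨ⟫) = ∫ (χ(⟪u, (u·∇)Ψ⟫ + ⟪f, Ψ⟫) + (Dχ·u)⟪u, Ψ⟫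
  + ν(2Σᵢ ∂ᵢχ⟪u, ∂ᵢΨ⟫ + Δχ⟪u, Ψ⟫) + p Dχ·Ψ)`
(the `χ⟪u, ΔΨ⟫` terms cancel; Fabes–Jones–Rivière 1972, §2, proof of Thm. 2.1, with the
cut-off bookkeeping made explicit). [cite: FabesJonesRiviere1972, §2 Thm. 2.1] -/
theorem IsClassicalNSSolutionOn.integral_duality_slice_eq {S : Set ℝ}
    (h : IsClassicalNSSolutionOn S ν f u p) (hS : UniqueDiffOn ℝ S) {τ : ℝ} (hτ : τ ∈ S)
    {Ψ : E → E} (hΨ : ContDiff ℝ 2 Ψ) (hdiv : VectorCalculus.IsDivFree Ψ) {χ : E → ℝ} (hχ : ContDiff ℝ 2 χ)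
    (hχc : HasCompactSupport χ) :
    ∫ x, (⟪timeDerivWithin S u τ x, χ x • Ψ x⟫ - ν * (χ x * ⟪u τ x, (Δ Ψ) x⟫)) =
      ∫ x, (χ x * (⟪u τ x, convect (u τ) Ψ x⟫ + ⟪f τ x, Ψ x⟫) +
        fderiv ℝ χ x (u τ x) * ⟪u τ x, Ψ x⟫ +
        ν * (2 * ∑ i, fderiv ℝ χ x (stdOrthonormalBasis ℝ E i) *
          ⟪u τ x, fderiv ℝ Ψ x (stdOrthonormalBasis ℝ E i)⟫ + (Δ χ) x * ⟪u τ x, Ψ x⟫) +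
        p τ x * fderiv ℝ χ x (Ψ x)) := by
  set b := stdOrthonormalBasis ℝ E with hb
  set w : E → E := fun x => χ x • Ψ x with hw
  have hw2 : ContDiff ℝ 2 w := hχ.smul hΨ
  have hw1 : ContDiff ℝ 1 w := hw2.of_le one_le_two
  have hwc : HasCompactSupport w := hχc.smul_right
  have hslice := h.integral_inner_timeDerivWithin_eq hS hτ hw2 hwc
  -- regularity of the slices
  have hu1 : ContDiff ℝ 1 (u τ) := contDiff_infty.1 (h.contDiff_velocity hτ) 1
  have huc : Continuous (u τ) := hu1.continuous
  have hpc : Continuous (p τ) := (h.contDiff_pressure hτ).continuous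
  have hfc : Continuous (f τ) := h.continuous_force_slice hS hτ
  have hdtc : Continuous (timeDerivWithin S u τ) :=
    ((h.smooth_velocity.timeDerivWithin hS).contDiff_slice hτ).continuous
  have hΨ1 : ContDiff ℝ 1 Ψ := hΨ.of_le one_le_two
  have hχ1 : ContDiff ℝ 1 χ := hχ.of_le one_le_two
  have hχc' : Continuous χ := hχ.continuous
  have hΔΨc : Continuous (Δ Ψ) := continuous_laplacian hΨ
  -- compact support: everything vanishes off `K = tsupport χ`
  set K : Set E := tsupport χ with hK
  have hKc : IsCompact K := hχc
  have hχK : ∀ x ∉ K, χ x = 0 := fun x hx => image_eq_zero_of_notMem_tsupport hx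
  have hwK : ∀ x ∉ K, x ∉ tsupport w := fun x hx h' => hx (tsupport_smul_subset_left χ Ψ h')
  -- pointwise expansion
  have hpt : ∀ x, ⟪u τ x, convect (u τ) w x⟫ + ν * ⟪u τ x, (Δ w) x⟫ + p τ x * VectorCalculus.divergence w x +
      ⟪f τ x, w x⟫ - ν * (χ x * ⟪u τ x, (Δ Ψ) x⟫) =
      χ x * (⟪u τ x, convect (u τ) Ψ x⟫ + ⟪f τ x, Ψ x⟫) +
        fderiv ℝ χ x (u τ x) * ⟪u τ x, Ψ x⟫ +
        ν * (2 * ∑ i, fderiv ℝ χ x (b i) * ⟪u τ x, fderiv ℝ Ψ x (b i)⟫ +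
          (Δ χ) x * ⟪u τ x, Ψ x⟫) +
        p τ x * fderiv ℝ χ x (Ψ x) := by
    intro x
    have e1 : convect (u τ) w x = χ x • convect (u τ) Ψ x + (fderiv ℝ χ x (u τ x)) • Ψ x :=
      convect_smul_apply (hχ1.differentiable one_ne_zero x) (hΨ1.differentiable one_ne_zero x)
    have e2 : (Δ w) x = χ x • (Δ Ψ) x +
        (2 : ℝ) • ∑ i, (fderiv ℝ χ x (b i)) • fderiv ℝ Ψ x (b i) + ((Δ χ) x) • Ψ x :=
      laplacian_smul_apply hχ hΨ x
    have e3 : VectorCalculus.divergence w x = χ x * VectorCalculus.divergence Ψ x + ⟪Ψ x, gradient χ x⟫ :=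
      divergence_smul_apply (hχ1.differentiable one_ne_zero x) (hΨ1.differentiable one_ne_zero x)
    have e4 : ⟪Ψ x, gradient χ x⟫ = fderiv ℝ χ x (Ψ x) := by
      rw [gradient, real_inner_comm, InnerProductSpace.toDual_symm_apply]
    have e5 : w x = χ x • Ψ x := rfl
    rw [e1, e2, e3, e4, hdiv x, e5]
    simp only [inner_add_right, real_inner_smul_right, inner_sum]
    ring
  -- integrability
  have iA : Integrable (fun x => ⟪u τ x, convect (u τ) w x⟫ + ν * ⟪u τ x, (Δ w) x⟫ +
      p τ x * VectorCalculus.divergence w x + ⟪f τ x, w x⟫) (volume : Measure E) := by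
    refine Continuous.integrable_of_hasCompactSupport ?_ (HasCompactSupport.intro hKc ?_)
    · exact (((huc.inner ((hw1.continuous_fderiv one_ne_zero).clm_apply huc)).add
        (continuous_const.mul (huc.inner (continuous_laplacian hw2)))).add
        (hpc.mul (continuous_divergence (hw1.continuous_fderiv one_ne_zero)))).add
        (hfc.inner hw2.continuous)
    · intro x hx
      have hxw := hwK x hx
      simp [convect, fderiv_of_notMem_tsupport ℝ hxw, laplacian_eq_zero_of_notMem_tsupport hxw,
        divergence_eq_zero_of_notMem_tsupport hxw, image_eq_zero_of_notMem_tsupport hxw]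
  have iB : Integrable (fun x => ν * (χ x * ⟪u τ x, (Δ Ψ) x⟫)) (volume : Measure E) := by
    refine Continuous.integrable_of_hasCompactSupport ?_ (HasCompactSupport.intro hKc ?_)
    · exact continuous_const.mul (hχc'.mul (huc.inner hΔΨc))
    · intro x hx
      simp [hχK x hx]
  have iT : Integrable (fun x => ⟪timeDerivWithin S u τ x, w x⟫) (volume : Measure E) :=
    integrable_inner_of_hasCompactSupport_right hdtc hw2.continuous hwc
  rw [integral_sub iT iB, hslice, ← integral_sub iA iB]
  exact integral_congr_ae (Eventually.of_forall hpt)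

end Duality

/-! ### Step 3: the limit `R → ∞` and the discharge -/

section Mild

variable {E : Type*} [NormedAddCommGroup E] [InnerProductSpace ℝ E] [FiniteDimensional ℝ E]
  [MeasurableSpace E] [BorelSpace E]

/-- **Removing the cut-off by dominated convergence**: for integrable `g`,
`∫ cutoff (n + 1) · g → ∫ g` as `n → ∞` (`|cutoff| ≤ 1`, `cutoff (n + 1) x → 1`). [folklore] -/
theorem tendsto_integral_cutoff_mul {g : E → ℝ} (hg : Integrable g) :
    Tendsto (fun n : ℕ => ∫ x, cutoff ((n : ℝ) + 1) x * g x) atTop (𝓝 (∫ x, g x)) := by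
  refine tendsto_integral_filter_of_dominated_convergence (fun x => ‖g x‖) ?_ ?_ hg.norm ?_
  · exact Eventually.of_forall fun n =>
      ((contDiff_cutoff (n := 0) _).continuous.aestronglyMeasurable.mul hg.1)
  · refine Eventually.of_forall fun n => Eventually.of_forall fun x => ?_
    rw [norm_mul, Real.norm_eq_abs]
    exact mul_le_of_le_one_left (norm_nonneg _) (abs_cutoff_le_one _ _)
  · exact Eventually.of_forall fun x => by
      simpa using (tendsto_cutoff_natCast_add_one x).mul_const (g x)

variable {ν T : ℝ} {f u : ℝ → E → E} {p : ℝ → E → ℝ}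

/-- **Classical solutions are mild solutions** (Fabes–Jones–Rivière 1972, Thm. 2.1 (i); Kato 1984,
§1): discharge of the named fact `Literature.Analysis.FluidPDE.IsClassicalNSSolutionOn.isMildNSSolutionOn`. A
classical solution on `S ⊇ [0, T]` with `u`, `p`, `f` bounded on `[0, T] × E` and `0 < ν` is a
mild (duality-form) solution on `[0, T]` with datum `u 0`. Weak divergence-freeness of the slices
is `IsDivFree.isWeaklyDivFree_holds`; the duality identity at `t = 0` is a tautology, and for
`0 < t ≤ T` it is obtained from `cutoff_duality_ftc` + `integral_duality_slice_eq` with the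
cut-offs `cutoff (n + 1)` by letting `n → ∞`: at each `(τ, x)` the integrand is eventually equal
to `⟪u, (u·∇)ψ⟫ + ⟪f, ψ⟫` (`ψ(τ) = e^{ν(t-τ)Δ}φ`), it is dominated by `A‖ψ(τ,x)‖ + B‖Dψ(τ,x)‖`
(`u`, `p`, `f` bounded, `|Dcutoff| ≤ C`, `|Δcutoff| ≤ C`), and `‖ψ(τ)‖₁ ≤ ‖φ‖₁`,
`‖Dψ(τ)‖₁ ≤ ‖Dφ‖₁`; dominated convergence in `x`, then in `τ ∈ (0, t)`, and in the two boundary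
terms. [cite: FabesJonesRiviere1972, Thm. 2.1 (i)] -/
theorem IsClassicalNSSolutionOn.isMildNSSolutionOn_holds :
    IsClassicalNSSolutionOn.isMildNSSolutionOn (E := E) (ν := ν) (T := T) (f := f) (u := u)
      (p := p) := by
  intro S h hν hS hbu hbp hbf
  refine ⟨fun t ht => VectorCalculus.IsDivFree.isWeaklyDivFree_holds (h.divFree t (hS ht))
    (contDiff_infty.1 (h.contDiff_velocity (hS ht)) 1), fun t ht φ hφ hdiv => ?_⟩
  rcases ht.1.eq_or_lt with h0 | ht0
  · subst h0
    simp
  -- genuine case `0 < t ≤ T`: restrict to `[0, T]`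
  have htT : t ≤ T := ht.2
  have hT : 0 < T := ht0.trans_le htT
  set S₀ : Set ℝ := Icc 0 T with hS₀
  have hU : UniqueDiffOn ℝ S₀ := uniqueDiffOn_Icc hT
  have h₀ : IsClassicalNSSolutionOn S₀ ν f u p := h.mono hS hU
  have hIt : Icc 0 t ⊆ S₀ := Icc_subset_Icc le_rfl htT
  have h0S : (0 : ℝ) ∈ S₀ := ⟨le_rfl, hT.le⟩
  set b := stdOrthonormalBasis ℝ E with hb
  -- bounds on `u`, `p`, `f`
  obtain ⟨Mu, hMu⟩ := hbu
  obtain ⟨Mp, hMp⟩ := hbp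
  obtain ⟨Mf, hMf⟩ := hbf
  have hMu0 : 0 ≤ Mu := (norm_nonneg _).trans (hMu 0 h0S 0)
  have hMp0 : 0 ≤ Mp := (norm_nonneg _).trans (hMp 0 h0S 0)
  have hMf0 : 0 ≤ Mf := (norm_nonneg _).trans (hMf 0 h0S 0)
  -- cut-off constants
  obtain ⟨C₁, hC₁0, hC₁⟩ := exists_norm_fderiv_cutoff_le (E := E)
  obtain ⟨C₂, hC₂0, hC₂⟩ := exists_abs_laplacian_cutoff_le (E := E)
  have hR : ∀ n : ℕ, (0 : ℝ) < n + 1 := fun n => by positivity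
  have hR1 : ∀ n : ℕ, (1 : ℝ) ≤ n + 1 := fun n => by
    have : (0 : ℝ) ≤ n := n.cast_nonneg
    linarith
  have hDχ : ∀ (n : ℕ) (x : E), ‖fderiv ℝ (cutoff ((n : ℝ) + 1)) x‖ ≤ C₁ := fun n x =>
    (hC₁ _ (hR n) x).trans (div_le_self hC₁0 (hR1 n))
  have hΔχ : ∀ (n : ℕ) (x : E), |(Δ (cutoff ((n : ℝ) + 1) : E → ℝ)) x| ≤ C₂ := fun n x =>
    (hC₂ _ (hR n) x).trans (div_le_self hC₂0 (by nlinarith [hR1 n]))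
  -- the test field
  have hφi : ContDiff ℝ ∞ φ := hφ.contDiff
  have hφ2 : ContDiff ℝ 2 φ := contDiff_infty.1 hφi 2
  have hφ1 : ContDiff ℝ 1 φ := contDiff_infty.1 hφi 1
  have hφc : HasCompactSupport φ := hφ.hasCompactSupport
  have hφc' : Continuous φ := hφi.continuous
  obtain ⟨Cφ, hCφ⟩ := hφc'.bounded_above_of_compact_support hφc
  have hDφc : Continuous (fderiv ℝ φ) := hφ1.continuous_fderiv one_ne_zero
  have hDφs : HasCompactSupport (fderiv ℝ φ) := hφc.fderiv ℝ
  obtain ⟨CDφ, hCDφ⟩ := hDφc.bounded_above_of_compact_support hDφs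
  have hφint : Integrable φ (volume : Measure E) := hφc'.integrable_of_hasCompactSupport hφc
  have hDφint : Integrable (fderiv ℝ φ) (volume : Measure E) :=
    hDφc.integrable_of_hasCompactSupport hDφs
  -- the caloric test field `Ψ τ = e^{ν(t-τ)Δ} φ`
  set Ψ : ℝ → E → E := fun τ => heatTest ν φ (t - τ) with hΨ
  have hΨsm : ∀ τ, ContDiff ℝ 2 (Ψ τ) := fun τ => contDiff_heatFlow hφ2 hφc _
  have hΨcs : ∀ τ, Continuous (Ψ τ) := fun τ => (hΨsm τ).continuous
  have hΨdiv : ∀ τ, VectorCalculus.IsDivFree (Ψ τ) := fun τ => isDivFree_heatFlow hφ1 hφc hdiv _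
  have hDΨ : ∀ τ x, fderiv ℝ (Ψ τ) x = heatFlow (fderiv ℝ φ) (ν * (t - τ)) x := fun τ x =>
    fderiv_heatFlow hφ1 hφc _ x
  have hΨc : Continuous (uncurry Ψ) := continuous_uncurry_heatTest_sub hφc' hCφ ν t
  have hDΨc : Continuous fun q : ℝ × E => fderiv ℝ (Ψ q.1) q.2 := by
    simp only [hDΨ]
    exact continuous_uncurry_heatTest_sub hDφc hCDφ ν t
  have hDΨcs : ∀ τ, Continuous fun x => fderiv ℝ (Ψ τ) x := fun τ =>
    hDΨc.comp (Continuous.prodMk_right τ)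
  have hΨint : ∀ τ, Integrable (Ψ τ) (volume : Measure E) := fun τ => integrable_heatFlow hφint _
  have hDΨint : ∀ τ, Integrable (fun x => fderiv ℝ (Ψ τ) x) (volume : Measure E) := fun τ => by
    simp only [hDΨ]
    exact integrable_heatFlow hDφint _
  have hΨL1 : ∀ τ, ∫ x, ‖Ψ τ x‖ ≤ ∫ x, ‖φ x‖ := fun τ => integral_norm_heatFlow_le hφint _
  have hDΨL1 : ∀ τ, ∫ x, ‖fderiv ℝ (Ψ τ) x‖ ≤ ∫ x, ‖fderiv ℝ φ x‖ := fun τ => by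
    simp only [hDΨ]
    exact integral_norm_heatFlow_le hDφint _
  -- continuity of the data on `[0, t] × E`
  have hu_cont : ContinuousOn (uncurry u) (Icc 0 t ×ˢ univ) :=
    h₀.smooth_velocity.continuousOn.mono (prod_mono hIt Subset.rfl)
  have hp_cont : ContinuousOn (uncurry p) (Icc 0 t ×ˢ univ) :=
    h₀.smooth_pressure.continuousOn.mono (prod_mono hIt Subset.rfl)
  have hf_cont : ContinuousOn (uncurry f) (Icc 0 t ×ˢ univ) :=
    (h₀.continuousOn_force hU).mono (prod_mono hIt Subset.rfl)
  have hucs : ∀ τ ∈ Icc 0 t, Continuous (u τ) := fun τ hτ =>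
    (h₀.contDiff_velocity (hIt hτ)).continuous
  have hfcs : ∀ τ ∈ Icc 0 t, Continuous (f τ) := fun τ hτ =>
    h₀.continuous_force_slice hU (hIt hτ)
  -- the two limit integrands
  have hAc : ContinuousOn (fun q : ℝ × E => ⟪u q.1 q.2, convect (u q.1) (Ψ q.1) q.2⟫)
      (Icc 0 t ×ˢ univ) := hu_cont.inner (hDΨc.continuousOn.clm_apply hu_cont)
  have hBc : ContinuousOn (fun q : ℝ × E => ⟪f q.1 q.2, Ψ q.1 q.2⟫) (Icc 0 t ×ˢ univ) :=
    hf_cont.inner hΨc.continuousOn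
  have hAb : ∀ τ ∈ Icc 0 t, ∀ x, |⟪u τ x, convect (u τ) (Ψ τ) x⟫| ≤
      Mu * Mu * ‖fderiv ℝ (Ψ τ) x‖ := by
    intro τ hτ x
    have b1 : ‖u τ x‖ ≤ Mu := hMu τ (hIt hτ) x
    calc |⟪u τ x, convect (u τ) (Ψ τ) x⟫| ≤ ‖u τ x‖ * ‖fderiv ℝ (Ψ τ) x (u τ x)‖ :=
          abs_real_inner_le_norm _ _
      _ ≤ Mu * (‖fderiv ℝ (Ψ τ) x‖ * Mu) :=
          mul_le_mul b1 ((ContinuousLinearMap.le_opNorm _ _).trans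
            (mul_le_mul_of_nonneg_left b1 (norm_nonneg _))) (norm_nonneg _) hMu0
      _ = Mu * Mu * ‖fderiv ℝ (Ψ τ) x‖ := by ring
  have hBb : ∀ τ ∈ Icc 0 t, ∀ x, |⟪f τ x, Ψ τ x⟫| ≤ Mf * ‖Ψ τ x‖ := fun τ hτ x =>
    (abs_real_inner_le_norm _ _).trans (mul_le_mul_of_nonneg_right (hMf τ (hIt hτ) x)
      (norm_nonneg _))
  have iA : ∀ τ ∈ Icc 0 t, Integrable (fun x => ⟪u τ x, convect (u τ) (Ψ τ) x⟫)
      (volume : Measure E) := fun τ hτ =>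
    Integrable.mono' (((hDΨint τ).norm.const_mul (Mu * Mu)))
      ((hucs τ hτ).inner ((hDΨcs τ).clm_apply (hucs τ hτ))).aestronglyMeasurable
      (Eventually.of_forall fun x => by rw [Real.norm_eq_abs]; exact hAb τ hτ x)
  have iB : ∀ τ ∈ Icc 0 t, Integrable (fun x => ⟪f τ x, Ψ τ x⟫) (volume : Measure E) :=
    fun τ hτ =>
    Integrable.mono' ((hΨint τ).norm.const_mul Mf)
      ((hfcs τ hτ).inner (hΨcs τ)).aestronglyMeasurable
      (Eventually.of_forall fun x => by rw [Real.norm_eq_abs]; exact hBb τ hτ x)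
  -- the cut-off integrands `F n` and their limit `Fl`
  set F : ℕ → ℝ → E → ℝ := fun n τ x =>
    cutoff ((n : ℝ) + 1) x * (⟪u τ x, convect (u τ) (Ψ τ) x⟫ + ⟪f τ x, Ψ τ x⟫) +
      fderiv ℝ (cutoff ((n : ℝ) + 1)) x (u τ x) * ⟪u τ x, Ψ τ x⟫ +
      ν * (2 * ∑ i, fderiv ℝ (cutoff ((n : ℝ) + 1)) x (b i) *
        ⟪u τ x, fderiv ℝ (Ψ τ) x (b i)⟫ +
        (Δ (cutoff ((n : ℝ) + 1) : E → ℝ)) x * ⟪u τ x, Ψ τ x⟫) +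
      p τ x * fderiv ℝ (cutoff ((n : ℝ) + 1)) x (Ψ τ x) with hF
  set Fl : ℝ → E → ℝ := fun τ x => ⟪u τ x, convect (u τ) (Ψ τ) x⟫ + ⟪f τ x, Ψ τ x⟫ with hFl
  -- (i) the identity for each `n`
  have hident : ∀ n : ℕ, (∫ x, cutoff ((n : ℝ) + 1) x * ⟪u t x, φ x⟫) -
      ∫ x, cutoff ((n : ℝ) + 1) x * ⟪u 0 x, heatTest ν φ t x⟫ = ∫ τ in 0..t, ∫ x, F n τ x := by
    intro n
    have h1 := h₀.cutoff_duality_ftc hν ht0 htT hφi hφc (contDiff_cutoff _)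
      (hasCompactSupport_cutoff (hR n))
    have h2 : EqOn (fun τ => ∫ x, (⟪timeDerivWithin S₀ u τ x, cutoff ((n : ℝ) + 1) x • Ψ τ x⟫ -
        ν * (cutoff ((n : ℝ) + 1) x * ⟪u τ x, (Δ (Ψ τ)) x⟫))) (fun τ => ∫ x, F n τ x)
        (uIcc 0 t) := by
      intro τ hτ
      rw [uIcc_of_le ht0.le] at hτ
      exact h₀.integral_duality_slice_eq hU (hIt hτ) (hΨsm τ) (hΨdiv τ) (contDiff_cutoff _)
        (hasCompactSupport_cutoff (hR n))
    have h3 := intervalIntegral.integral_congr (μ := volume) h2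
    have hL : (∫ x, cutoff ((n : ℝ) + 1) x * ⟪u t x, φ x⟫) -
        ∫ x, cutoff ((n : ℝ) + 1) x * ⟪u 0 x, heatTest ν φ t x⟫ =
        (∫ x, ⟪u t x, cutoff ((n : ℝ) + 1) x • φ x⟫) -
          ∫ x, ⟪u 0 x, cutoff ((n : ℝ) + 1) x • heatTest ν φ t x⟫ := by
      simp only [real_inner_smul_right]
    exact (hL.trans h1).trans h3
  -- (ii) joint continuity and compact support of `F n`
  have hFc : ∀ n, ContinuousOn (uncurry (F n)) (Icc 0 t ×ˢ univ) := by
    intro n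
    have hχ : ContDiff ℝ 2 (cutoff ((n : ℝ) + 1) : E → ℝ) := contDiff_cutoff _
    have c1 : Continuous (cutoff ((n : ℝ) + 1) : E → ℝ) := hχ.continuous
    have c2 : Continuous (fderiv ℝ (cutoff ((n : ℝ) + 1) : E → ℝ)) :=
      (hχ.of_le one_le_two).continuous_fderiv one_ne_zero
    have c3 : Continuous (Δ (cutoff ((n : ℝ) + 1) : E → ℝ)) := continuous_laplacian hχ
    have huΨ : ContinuousOn (fun q : ℝ × E => ⟪u q.1 q.2, Ψ q.1 q.2⟫) (Icc 0 t ×ˢ univ) :=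
      hu_cont.inner hΨc.continuousOn
    have T1 : ContinuousOn (fun q : ℝ × E => cutoff ((n : ℝ) + 1) q.2 *
        (⟪u q.1 q.2, convect (u q.1) (Ψ q.1) q.2⟫ + ⟪f q.1 q.2, Ψ q.1 q.2⟫)) (Icc 0 t ×ˢ univ) :=
      (c1.comp continuous_snd).continuousOn.mul (hAc.add hBc)
    have T2 : ContinuousOn (fun q : ℝ × E => fderiv ℝ (cutoff ((n : ℝ) + 1)) q.2 (u q.1 q.2) *
        ⟪u q.1 q.2, Ψ q.1 q.2⟫) (Icc 0 t ×ˢ univ) :=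
      ((c2.comp continuous_snd).continuousOn.clm_apply hu_cont).mul huΨ
    have T3 : ContinuousOn (fun q : ℝ × E => ν * (2 * ∑ i, fderiv ℝ (cutoff ((n : ℝ) + 1)) q.2
        (b i) * ⟪u q.1 q.2, fderiv ℝ (Ψ q.1) q.2 (b i)⟫ +
        (Δ (cutoff ((n : ℝ) + 1) : E → ℝ)) q.2 * ⟪u q.1 q.2, Ψ q.1 q.2⟫)) (Icc 0 t ×ˢ univ) := by
      refine continuousOn_const.mul ((continuousOn_const.mul (continuousOn_finsetSum _
        fun i _ => ?_)).add ((c3.comp continuous_snd).continuousOn.mul huΨ))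
      exact ((c2.comp continuous_snd).clm_apply continuous_const).continuousOn.mul
        (hu_cont.inner (hDΨc.continuousOn.clm_apply continuousOn_const))
    have T4 : ContinuousOn (fun q : ℝ × E => p q.1 q.2 *
        fderiv ℝ (cutoff ((n : ℝ) + 1)) q.2 (Ψ q.1 q.2)) (Icc 0 t ×ˢ univ) :=
      hp_cont.mul ((c2.comp continuous_snd).continuousOn.clm_apply hΨc.continuousOn)
    exact ((T1.add T2).add T3).add T4
  have hFK : ∀ (n : ℕ) (τ : ℝ), ∀ x ∉ closedBall (0 : E) (2 * ((n : ℝ) + 1)), F n τ x = 0 := by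
    intro n τ x hx
    have hx' : x ∉ tsupport (cutoff ((n : ℝ) + 1) : E → ℝ) := fun h' =>
      hx (tsupport_cutoff_subset (hR n) h')
    simp [hF, image_eq_zero_of_notMem_tsupport hx', fderiv_of_notMem_tsupport ℝ hx',
      laplacian_eq_zero_of_notMem_tsupport hx']
  have hFcs : ∀ n, ∀ τ ∈ Icc 0 t, Continuous (F n τ) := by
    intro n τ hτ
    have := (hFc n).comp_continuous (Continuous.prodMk_right τ) fun x => ⟨hτ, mem_univ x⟩
    simpa [Function.comp_def] using this
  have hGc : ∀ n, ContinuousOn (fun τ => ∫ x, F n τ x) (Icc 0 t) := fun n =>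
    continuousOn_integral_of_support_subset (μ := volume) (isCompact_closedBall 0 _) (hFc n)
      fun τ _ x hx => hFK n τ x hx
  -- (iii) the dominating function
  set A : ℝ := Mf + C₁ * Mu * Mu + ν * C₂ * Mu + Mp * C₁ with hA
  set B : ℝ := Mu * Mu + ν * 2 * (Module.finrank ℝ E : ℝ) * C₁ * Mu with hB
  have hA0 : 0 ≤ A := by rw [hA]; positivity
  have hB0 : 0 ≤ B := by rw [hB]; positivity
  have hbound : ∀ n, ∀ τ ∈ Icc 0 t, ∀ x,
      ‖F n τ x‖ ≤ A * ‖Ψ τ x‖ + B * ‖fderiv ℝ (Ψ τ) x‖ := by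
    intro n τ hτ x
    have hτ' : τ ∈ S₀ := hIt hτ
    have b1 : ‖u τ x‖ ≤ Mu := hMu τ hτ' x
    have b2 : |p τ x| ≤ Mp := by simpa only [Real.norm_eq_abs] using hMp τ hτ' x
    have b4 : |cutoff ((n : ℝ) + 1) x| ≤ 1 := abs_cutoff_le_one _ _
    have b5 : ‖fderiv ℝ (cutoff ((n : ℝ) + 1)) x‖ ≤ C₁ := hDχ n x
    have b6 : |(Δ (cutoff ((n : ℝ) + 1) : E → ℝ)) x| ≤ C₂ := hΔχ n x
    have hlin : ∀ v : E, |fderiv ℝ (cutoff ((n : ℝ) + 1)) x v| ≤ C₁ * ‖v‖ := fun v => by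
      rw [← Real.norm_eq_abs]
      exact (ContinuousLinearMap.le_opNorm _ _).trans (mul_le_mul_of_nonneg_right b5
        (norm_nonneg _))
    have e4 : |⟪u τ x, Ψ τ x⟫| ≤ Mu * ‖Ψ τ x‖ :=
      (abs_real_inner_le_norm _ _).trans (mul_le_mul_of_nonneg_right b1 (norm_nonneg _))
    -- term 1
    have hT1 : |cutoff ((n : ℝ) + 1) x * (⟪u τ x, convect (u τ) (Ψ τ) x⟫ + ⟪f τ x, Ψ τ x⟫)| ≤
        1 * (Mu * Mu * ‖fderiv ℝ (Ψ τ) x‖ + Mf * ‖Ψ τ x‖) := by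
      rw [abs_mul]
      exact mul_le_mul b4 ((abs_add_le _ _).trans (add_le_add (hAb τ hτ x) (hBb τ hτ x)))
        (abs_nonneg _) zero_le_one
    -- term 2
    have hT2 : |fderiv ℝ (cutoff ((n : ℝ) + 1)) x (u τ x) * ⟪u τ x, Ψ τ x⟫| ≤
        C₁ * Mu * (Mu * ‖Ψ τ x‖) := by
      rw [abs_mul]
      refine mul_le_mul ((hlin _).trans (mul_le_mul_of_nonneg_left b1 hC₁0)) e4 (abs_nonneg _)
        (by positivity)
    -- term 3
    have e5 : ∀ i, |fderiv ℝ (cutoff ((n : ℝ) + 1)) x (b i) *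
        ⟪u τ x, fderiv ℝ (Ψ τ) x (b i)⟫| ≤ C₁ * (Mu * ‖fderiv ℝ (Ψ τ) x‖) := fun i => by
      rw [abs_mul]
      refine mul_le_mul ?_ ?_ (abs_nonneg _) hC₁0
      · simpa [b.orthonormal.1 i] using hlin (b i)
      · refine (abs_real_inner_le_norm _ _).trans (mul_le_mul b1 ?_ (norm_nonneg _) hMu0)
        simpa [b.orthonormal.1 i] using ContinuousLinearMap.le_opNorm (fderiv ℝ (Ψ τ) x) (b i)
    have e6 : |∑ i, fderiv ℝ (cutoff ((n : ℝ) + 1)) x (b i) * ⟪u τ x, fderiv ℝ (Ψ τ) x (b i)⟫| ≤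
        (Module.finrank ℝ E : ℝ) * (C₁ * (Mu * ‖fderiv ℝ (Ψ τ) x‖)) := by
      refine (Finset.abs_sum_le_sum_abs _ _).trans ?_
      refine (Finset.sum_le_sum fun i _ => e5 i).trans ?_
      simp
    have hT3 : |ν * (2 * ∑ i, fderiv ℝ (cutoff ((n : ℝ) + 1)) x (b i) *
        ⟪u τ x, fderiv ℝ (Ψ τ) x (b i)⟫ + (Δ (cutoff ((n : ℝ) + 1) : E → ℝ)) x * ⟪u τ x, Ψ τ x⟫)| ≤
        ν * (2 * ((Module.finrank ℝ E : ℝ) * (C₁ * (Mu * ‖fderiv ℝ (Ψ τ) x‖))) +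
          C₂ * (Mu * ‖Ψ τ x‖)) := by
      rw [abs_mul, abs_of_pos hν]
      refine mul_le_mul_of_nonneg_left ((abs_add_le _ _).trans (add_le_add ?_ ?_)) hν.le
      · rw [abs_mul, abs_two]
        exact mul_le_mul_of_nonneg_left e6 zero_le_two
      · rw [abs_mul]
        exact mul_le_mul b6 e4 (abs_nonneg _) hC₂0
    -- term 4
    have hT4 : |p τ x * fderiv ℝ (cutoff ((n : ℝ) + 1)) x (Ψ τ x)| ≤ Mp * (C₁ * ‖Ψ τ x‖) := by
      rw [abs_mul]
      exact mul_le_mul b2 (hlin _) (abs_nonneg _) hMp0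
    rw [Real.norm_eq_abs]
    calc |F n τ x| ≤ |cutoff ((n : ℝ) + 1) x * (⟪u τ x, convect (u τ) (Ψ τ) x⟫ + ⟪f τ x, Ψ τ x⟫)| +
          |fderiv ℝ (cutoff ((n : ℝ) + 1)) x (u τ x) * ⟪u τ x, Ψ τ x⟫| +
          |ν * (2 * ∑ i, fderiv ℝ (cutoff ((n : ℝ) + 1)) x (b i) *
            ⟪u τ x, fderiv ℝ (Ψ τ) x (b i)⟫ +
            (Δ (cutoff ((n : ℝ) + 1) : E → ℝ)) x * ⟪u τ x, Ψ τ x⟫)| +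
          |p τ x * fderiv ℝ (cutoff ((n : ℝ) + 1)) x (Ψ τ x)| :=
          (abs_add_le _ _).trans (add_le_add ((abs_add_le _ _).trans
            (add_le_add (abs_add_le _ _) le_rfl)) le_rfl)
      _ ≤ 1 * (Mu * Mu * ‖fderiv ℝ (Ψ τ) x‖ + Mf * ‖Ψ τ x‖) + C₁ * Mu * (Mu * ‖Ψ τ x‖) +
          ν * (2 * ((Module.finrank ℝ E : ℝ) * (C₁ * (Mu * ‖fderiv ℝ (Ψ τ) x‖))) +
            C₂ * (Mu * ‖Ψ τ x‖)) + Mp * (C₁ * ‖Ψ τ x‖) :=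
          add_le_add (add_le_add (add_le_add hT1 hT2) hT3) hT4
      _ = A * ‖Ψ τ x‖ + B * ‖fderiv ℝ (Ψ τ) x‖ := by
          rw [hA, hB]
          ring
  -- (iv) dominated convergence in `x` at every fixed `τ ∈ [0, t]`
  have hinner : ∀ τ ∈ Icc 0 t,
      Tendsto (fun n : ℕ => ∫ x, F n τ x) atTop (𝓝 (∫ x, Fl τ x)) := by
    intro τ hτ
    refine tendsto_integral_filter_of_dominated_convergence
      (fun x => A * ‖Ψ τ x‖ + B * ‖fderiv ℝ (Ψ τ) x‖) ?_ ?_ ?_ ?_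
    · exact Eventually.of_forall fun n => (hFcs n τ hτ).aestronglyMeasurable
    · exact Eventually.of_forall fun n => Eventually.of_forall fun x => hbound n τ hτ x
    · exact ((hΨint τ).norm.const_mul A).add ((hDΨint τ).norm.const_mul B)
    · refine Eventually.of_forall fun x => tendsto_const_nhds.congr' ?_
      have hev : ∀ᶠ n : ℕ in atTop, ‖x‖ < (n : ℝ) + 1 := by
        filter_upwards [(tendsto_natCast_atTop_atTop (R := ℝ)).eventually_gt_atTop ‖x‖] with n hn
        exact hn.trans (lt_add_one _)
      filter_upwards [hev] with n hn
      have c1 : cutoff ((n : ℝ) + 1) x = 1 := cutoff_eq_one (hR n) hn.le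
      have c2 : fderiv ℝ (cutoff ((n : ℝ) + 1)) x = 0 := fderiv_cutoff_eq_zero (hR n) hn
      have c3 : (Δ (cutoff ((n : ℝ) + 1) : E → ℝ)) x = 0 := laplacian_cutoff_eq_zero (hR n) hn
      simp [hF, hFl, c1, c2, c3]
  -- (v) the uniform bound on the inner integrals
  have hGbound : ∀ n, ∀ τ ∈ Icc 0 t,
      ‖∫ x, F n τ x‖ ≤ A * (∫ x, ‖φ x‖) + B * ∫ x, ‖fderiv ℝ φ x‖ := by
    intro n τ hτ
    have i1 : Integrable (fun x => A * ‖Ψ τ x‖) (volume : Measure E) :=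
      (hΨint τ).norm.const_mul A
    have i2 : Integrable (fun x => B * ‖fderiv ℝ (Ψ τ) x‖) (volume : Measure E) :=
      (hDΨint τ).norm.const_mul B
    calc ‖∫ x, F n τ x‖ ≤ ∫ x, (A * ‖Ψ τ x‖ + B * ‖fderiv ℝ (Ψ τ) x‖) :=
          norm_integral_le_of_norm_le (i1.add i2) (Eventually.of_forall (hbound n τ hτ))
      _ = A * (∫ x, ‖Ψ τ x‖) + B * ∫ x, ‖fderiv ℝ (Ψ τ) x‖ := by
          rw [integral_add i1 i2, integral_const_mul, integral_const_mul]
      _ ≤ A * (∫ x, ‖φ x‖) + B * ∫ x, ‖fderiv ℝ φ x‖ :=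
          add_le_add (mul_le_mul_of_nonneg_left (hΨL1 τ) hA0)
            (mul_le_mul_of_nonneg_left (hDΨL1 τ) hB0)
  -- (vi) dominated convergence in `τ`
  have houter : Tendsto (fun n : ℕ => ∫ τ in 0..t, ∫ x, F n τ x) atTop
      (𝓝 (∫ τ in 0..t, ∫ x, Fl τ x)) := by
    refine intervalIntegral.tendsto_integral_filter_of_dominated_convergence
      (fun _ => A * (∫ x, ‖φ x‖) + B * ∫ x, ‖fderiv ℝ φ x‖) ?_ ?_ ?_ ?_
    · refine Eventually.of_forall fun n => ?_
      rw [uIoc_of_le ht0.le]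
      exact ((hGc n).mono Ioc_subset_Icc_self).aestronglyMeasurable measurableSet_Ioc
    · refine Eventually.of_forall fun n => Eventually.of_forall fun τ hτ => ?_
      rw [uIoc_of_le ht0.le] at hτ
      exact hGbound n τ (Ioc_subset_Icc_self hτ)
    · exact intervalIntegrable_const
    · refine Eventually.of_forall fun τ hτ => ?_
      rw [uIoc_of_le ht0.le] at hτ
      exact hinner τ (Ioc_subset_Icc_self hτ)
  -- (vii) the boundary terms
  have hlim_t : Tendsto (fun n : ℕ => ∫ x, cutoff ((n : ℝ) + 1) x * ⟪u t x, φ x⟫) atTop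
      (𝓝 (∫ x, ⟪u t x, φ x⟫)) :=
    tendsto_integral_cutoff_mul (integrable_inner_of_hasCompactSupport_right
      (hucs t ⟨ht0.le, le_rfl⟩) hφc' hφc)
  have hlim_0 : Tendsto (fun n : ℕ => ∫ x, cutoff ((n : ℝ) + 1) x * ⟪u 0 x, heatTest ν φ t x⟫)
      atTop (𝓝 (∫ x, ⟪u 0 x, heatTest ν φ t x⟫)) := by
    refine tendsto_integral_cutoff_mul ?_
    have hΨ0 : Integrable (heatTest ν φ t) (volume : Measure E) := integrable_heatFlow hφint _
    have hΨ0c : Continuous (heatTest ν φ t) := (contDiff_heatFlow hφ2 hφc _).continuous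
    refine Integrable.mono' (hΨ0.norm.const_mul Mu)
      ((hucs 0 ⟨le_rfl, ht0.le⟩).inner hΨ0c).aestronglyMeasurable (Eventually.of_forall fun x => ?_)
    rw [Real.norm_eq_abs]
    exact (abs_real_inner_le_norm _ _).trans (mul_le_mul_of_nonneg_right (hMu 0 h0S x)
      (norm_nonneg _))
  have hEq : (∫ x, ⟪u t x, φ x⟫) - ∫ x, ⟪u 0 x, heatTest ν φ t x⟫ = ∫ τ in 0..t, ∫ x, Fl τ x :=
    tendsto_nhds_unique ((hlim_t.sub hlim_0).congr hident) houter
  -- (viii) split the limit into the two terms of the duality identity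
  have hFl_split : EqOn (fun τ => ∫ x, Fl τ x)
      (fun τ => (∫ x, ⟪u τ x, convect (u τ) (Ψ τ) x⟫) + ∫ x, ⟪f τ x, Ψ τ x⟫) (uIcc 0 t) := by
    intro τ hτ
    rw [uIcc_of_le ht0.le] at hτ
    exact integral_add (iA τ hτ) (iB τ hτ)
  have hmeas : ∀ {G : ℝ × E → ℝ}, ContinuousOn G (Icc 0 t ×ˢ univ) →
      AEStronglyMeasurable (fun τ => ∫ x, G (τ, x)) (volume.restrict (Ioc 0 t)) := by
    intro G hG
    have h1 := (aestronglyMeasurable_prod_of_continuousOn hG).integral_prod_right'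
    rwa [Measure.restrict_congr_set Ioo_ae_eq_Ioc] at h1
  have ha : IntervalIntegrable (fun τ => ∫ x, ⟪u τ x, convect (u τ) (Ψ τ) x⟫) volume 0 t := by
    rw [intervalIntegrable_iff, uIoc_of_le ht0.le]
    refine Integrable.mono' (integrableOn_const (C := Mu * Mu * ∫ x, ‖fderiv ℝ φ x‖)
      measure_Ioc_lt_top.ne) (hmeas hAc) ?_
    refine (ae_restrict_iff' measurableSet_Ioc).2 (Eventually.of_forall fun τ hτ => ?_)
    have hτ' : τ ∈ Icc 0 t := Ioc_subset_Icc_self hτ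
    have i1 : Integrable (fun x => Mu * Mu * ‖fderiv ℝ (Ψ τ) x‖) (volume : Measure E) :=
      (hDΨint τ).norm.const_mul _
    calc ‖∫ x, ⟪u τ x, convect (u τ) (Ψ τ) x⟫‖ ≤ ∫ x, Mu * Mu * ‖fderiv ℝ (Ψ τ) x‖ :=
          norm_integral_le_of_norm_le i1 (Eventually.of_forall fun x => by
            rw [Real.norm_eq_abs]; exact hAb τ hτ' x)
      _ = Mu * Mu * ∫ x, ‖fderiv ℝ (Ψ τ) x‖ := integral_const_mul _ _
      _ ≤ Mu * Mu * ∫ x, ‖fderiv ℝ φ x‖ :=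
          mul_le_mul_of_nonneg_left (hDΨL1 τ) (mul_nonneg hMu0 hMu0)
  have hb' : IntervalIntegrable (fun τ => ∫ x, ⟪f τ x, Ψ τ x⟫) volume 0 t := by
    rw [intervalIntegrable_iff, uIoc_of_le ht0.le]
    refine Integrable.mono' (integrableOn_const (C := Mf * ∫ x, ‖φ x‖) measure_Ioc_lt_top.ne)
      (hmeas hBc) ?_
    refine (ae_restrict_iff' measurableSet_Ioc).2 (Eventually.of_forall fun τ hτ => ?_)
    have hτ' : τ ∈ Icc 0 t := Ioc_subset_Icc_self hτ
    have i1 : Integrable (fun x => Mf * ‖Ψ τ x‖) (volume : Measure E) :=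
      (hΨint τ).norm.const_mul _
    calc ‖∫ x, ⟪f τ x, Ψ τ x⟫‖ ≤ ∫ x, Mf * ‖Ψ τ x‖ :=
          norm_integral_le_of_norm_le i1 (Eventually.of_forall fun x => by
            rw [Real.norm_eq_abs]; exact hBb τ hτ' x)
      _ = Mf * ∫ x, ‖Ψ τ x‖ := integral_const_mul _ _
      _ ≤ Mf * ∫ x, ‖φ x‖ := mul_le_mul_of_nonneg_left (hΨL1 τ) hMf0
  rw [intervalIntegral.integral_congr hFl_split, intervalIntegral.integral_add ha hb'] at hEq
  show ∫ x, ⟪u t x, φ x⟫ = (∫ x, ⟪u 0 x, heatTest ν φ t x⟫) +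
    (∫ τ in 0..t, ∫ x, ⟪u τ x, convect (u τ) (Ψ τ) x⟫) + ∫ τ in 0..t, ∫ x, ⟪f τ x, Ψ τ x⟫
  linarith

end Mild

end Literature.Analysis.FluidPDE
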